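import Literature.NumberTheory.ComplexMultiplication.SharedImaginaryQuadraticDegenerate
import HarnessLib

/-!
# Two simple CM abelian varieties whose CM fields share an imaginary quadratic field: exceptional Hodge classes are
# FORCED on some product `∏ A_i^{k_i}` (the Weil classes of the shared field), even when each factor is nondegenerate

COR-CM (cell `pub-hodgecm2`, binder seat `b23` gen 28), count-neutral; NEW as stated, hence under `Summits/`.  The
negative companion of `Summits/HodgeConjecture/CorCM/RealIntersectionCMFieldsHodge` (partial conjugations — Galois
closures meeting in TOTALLY REAL fields — give `B• = D•` and the Hodge conjecture on every `∏_i A_i^{k_i}`).  The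
literature file `Literature.NumberTheory.ComplexMultiplication.SharedImaginaryQuadraticDegenerate` (this seat) shows that
when two of the CM fields `K_{i₀}`, `K_{i₁}` contain a common imaginary quadratic field `k` (embeddings `j₀`, `j₁`) and both
SIGNATURE DEFECTS of the types on `k` are non-zero (automatic for odd `[K_{i_κ} : k]`), the family `(Φ_i)` is DEGENERATE,
whatever the types.  With the tree's Hazama–Murty theorem for separating families
(`Pohlmann1968.CMAlgebra.exists_exceptional_prod_of_not_isNondegenerateFamily`) this file records the geometric upshot:

* **`exists_exceptional_prod_of_shared_quadratic`** — for a SEPARATING family (simple, pairwise CM-inequivalent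
  factors) of realisations, some product `⨁_{j<N} A_{π j}` carries a rational `(m,m)`-class OUTSIDE `Dᵐ ⊗ ℂ` — an
  exceptional Hodge class (a Weil class for `k`);
* **`exists_exceptional_prod_of_shared_quadratic_of_odd`** — the same under the degree condition
  `[K_{i₀} : ℚ]/2`, `[K_{i₁} : ℚ]/2` odd (e.g. two simple CM threefolds with different cyclic sextic CM fields through the same
  imaginary quadratic field: `ℚ(ζ_7)` and `ℚ(√−7)·ℚ(ζ_9)⁺`; or a CM elliptic curve `E_k` and a simple `A` with `k ⊆ End⁰(A)`
  of odd relative degree);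
* **`not_forall_prod_hodgeClassSpan_eq_of_shared_quadratic`** — `B• = D•` FAILS on some such product.

So for two-field products the partial-conjugation criterion is sharp in this direction: a shared imaginary quadratic
field with unbalanced signatures is exactly where the divisor regime ends and the (open) Weil-class regime begins.
Theorems only, no definition, no `sorry`; the exceptional classes are NOT claimed algebraic or non-algebraic.

## References

* [Gordon1999HodgeAVSurvey] B. B. Gordon, *A survey of the Hodge conjecture for abelian varieties*, 7.5–7.7 (Murty,
  Hazama), §3 Theorem (proof).
* [Deligne1982HodgeCycles] P. Deligne, *Hodge cycles on abelian varieties*, LNM 900 (1982), §4 (Weil classes).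
-/

noncomputable section

open CategoryTheory CategoryTheory.Limits NumberField NumberField.ComplexEmbedding Module

namespace Summit.HodgeConjecture.CorCM

open Literature.NumberTheory.ComplexMultiplication
open Literature.AlgebraicGeometry.Motives (AbelianVariety CMType)
open Literature.AlgebraicGeometry.HodgeTheory
open Literature.AlgebraicGeometry.ComplexMultiplication (IsCMTypeRealisation)
open Literature.AlgebraicGeometry.VanGeemen1994 (hodgeClassSpan)
open Literature.AlgebraicGeometry.Pohlmann1968
open Literature.Barriers.HodgeConjecture (divisorClassesSpan)

section Geometry

variable {I : Type} {K : I → Type} [∀ i, Field (K i)] [∀ i, NumberField (K i)] [∀ i, IsCMField (K i)] [Fintype I]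
  [Nonempty I] {Φ : ∀ i, CMType (K i)}
variable {A : I → AbelianVariety ℂ} {ι : ∀ i, 𝓞 (K i) →+* End (A i)}
  {θ : ∀ i, K i →+* Module.End ℂ (complexBetti (A i).X 1)}
variable {k : Type} [Field k] [NumberField k] [IsTotallyComplex k]

open scoped Classical in
/-- **A shared imaginary quadratic field forces an exceptional Hodge class.**  Let `(K_i; Φ_i)` be a separating family
(simple, pairwise CM-inequivalent realisations `A_i`), `k` imaginary quadratic with embeddings `j₀ : k → K_{i₀}`,
`j₁ : k → K_{i₁}` (`i₀ ≠ i₁`) and a complex embedding `ι₀`, and suppose both signature defects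
`Σ_{φ ∈ Φ_{i_κ}} sign(φ|_k)` are non-zero.  Then some product `⨁_{j<N} A_{π j}` carries a rational `(m,m)`-class outside
`Dᵐ ⊗ ℂ`. [cite: Gordon1999HodgeAVSurvey, 7.5] [cite: Deligne1982HodgeCycles, §4] -/
theorem exists_exceptional_prod_of_shared_quadratic (hsep : CMAlgebra.IsSeparatingFamily Φ) (hk : finrank ℚ k = 2)
    (ι₀ : k →+* ℂ) {i₀ i₁ : I} (h01 : i₀ ≠ i₁) (j₀ : k →+* K i₀) (j₁ : k →+* K i₁)
    (hd₀ : ∑ φ ∈ Finset.univ.filter (fun φ : K i₀ →+* ℂ => φ ∈ (Φ i₀).1),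
      (if φ.comp j₀ = ι₀ then (1 : ℚ) else -1) ≠ 0)
    (hd₁ : ∑ φ ∈ Finset.univ.filter (fun φ : K i₁ →+* ℂ => φ ∈ (Φ i₁).1),
      (if φ.comp j₁ = ι₀ then (1 : ℚ) else -1) ≠ 0)
    (hA : ∀ i, IsCMTypeRealisation (Φ i) (A i) (ι i) (θ i)) :
    ∃ (N : ℕ) (π : Fin N → I) (m : ℕ) (c : complexBetti (⨁ fun j : Fin N => A (π j)).X (2 * m)),
      IsRationalClass c ∧
      IsOfHodgeType (⨁ fun j : Fin N => A (π j)).dim (⨁ fun j : Fin N => A (π j)).X (2 * m) m m c ∧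
      c ∉ divisorClassesSpan (⨁ fun j : Fin N => A (π j)).X (⨁ fun j : Fin N => A (π j)).dim m :=
  CMAlgebra.exists_exceptional_prod_of_not_isNondegenerateFamily hsep
    (not_isNondegenerateFamily_of_shared_quadratic hk ι₀ h01 j₀ j₁ Φ hd₀ hd₁) hA

/-- **Odd relative degrees force an exceptional Hodge class**: a separating family two of whose CM fields contain the
imaginary quadratic field `k` with `[K_{i₀} : ℚ]/2` and `[K_{i₁} : ℚ]/2` odd (e.g. two simple CM threefolds with different
cyclic sextic CM fields through `k`, for ANY types; `E_k × A` with `k ⊆ K_A` of odd relative degree) has a product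
`⨁_{j<N} A_{π j}` with a rational `(m,m)`-class outside `Dᵐ ⊗ ℂ`. [cite: Gordon1999HodgeAVSurvey, 7.5] [cite: Deligne1982HodgeCycles, §4] -/
theorem exists_exceptional_prod_of_shared_quadratic_of_odd (hsep : CMAlgebra.IsSeparatingFamily Φ)
    (hk : finrank ℚ k = 2) (ι₀ : k →+* ℂ) {i₀ i₁ : I} (h01 : i₀ ≠ i₁) (j₀ : k →+* K i₀) (j₁ : k →+* K i₁)
    (h₀ : Odd (finrank ℚ (K i₀) / 2)) (h₁ : Odd (finrank ℚ (K i₁) / 2))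
    (hA : ∀ i, IsCMTypeRealisation (Φ i) (A i) (ι i) (θ i)) :
    ∃ (N : ℕ) (π : Fin N → I) (m : ℕ) (c : complexBetti (⨁ fun j : Fin N => A (π j)).X (2 * m)),
      IsRationalClass c ∧
      IsOfHodgeType (⨁ fun j : Fin N => A (π j)).dim (⨁ fun j : Fin N => A (π j)).X (2 * m) m m c ∧
      c ∉ divisorClassesSpan (⨁ fun j : Fin N => A (π j)).X (⨁ fun j : Fin N => A (π j)).dim m :=
  CMAlgebra.exists_exceptional_prod_of_not_isNondegenerateFamily hsep
    (not_isNondegenerateFamily_of_shared_quadratic_of_odd hk ι₀ h01 j₀ j₁ h₀ h₁ Φ) hA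

/-- **`B• = D•` fails on some product** of a separating family through a shared imaginary quadratic field with odd
relative degrees: not every `Bᵐ(⨁_{j<N} A_{π j}) ⊗ ℂ` equals `Dᵐ ⊗ ℂ` — in contrast with
`hodgeClassSpan_prod_eq_divisorClassesSpan_of_conj_apply_eq` for Galois closures meeting in totally real fields.
[cite: Gordon1999HodgeAVSurvey, 7.5] -/
theorem not_forall_prod_hodgeClassSpan_eq_of_shared_quadratic_of_odd (hsep : CMAlgebra.IsSeparatingFamily Φ)
    (hk : finrank ℚ k = 2) (ι₀ : k →+* ℂ) {i₀ i₁ : I} (h01 : i₀ ≠ i₁) (j₀ : k →+* K i₀) (j₁ : k →+* K i₁)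
    (h₀ : Odd (finrank ℚ (K i₀) / 2)) (h₁ : Odd (finrank ℚ (K i₁) / 2))
    (hA : ∀ i, IsCMTypeRealisation (Φ i) (A i) (ι i) (θ i)) :
    ¬ ∀ (N : ℕ) (π : Fin N → I) (m : ℕ),
      hodgeClassSpan (⨁ fun j : Fin N => A (π j)).dim (⨁ fun j : Fin N => A (π j)).X m =
        divisorClassesSpan (⨁ fun j : Fin N => A (π j)).X (⨁ fun j : Fin N => A (π j)).dim m := fun h =>
  not_isNondegenerateFamily_of_shared_quadratic_of_odd hk ι₀ h01 j₀ j₁ h₀ h₁ Φ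
    ((CMAlgebra.isNondegenerateFamily_iff_forall_prod_hodgeClassSpan_eq hsep hA).2 h)

end Geometry

end Summit.HodgeConjecture.CorCM

end
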